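import Literature.NumberTheory.Automorphic.UnitaryGroupKernelFiniteSum
import Literature.NumberTheory.Automorphic.AutomorphicQuotientKernelCompact
import Mathlib.Analysis.Normed.Module.FiniteDimension
import HarnessLib

/-!
# Dictionary: the T1-qs kernel `K(x, y) = Σ_{γ ∈ G(F)} f(x⁻¹ γ y)` of `U(J_N)` IS the kernel of the
# tree's integrated right regular representation (counting measure on `G(F)`); `K` is continuous
(Rogawski, *Automorphic Representations of Unitary Groups in Three Variables* (1990), §2.2 p. 13:
«the kernel `K_G(x, y)` of `ρ(f)`»; Gelbart, *Automorphic Forms on Adele Groups* (1975), (9.7),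
(9.20), Remark 9.23)

Topic `NumberTheory/Automorphic`; namespace `Literature.NumberTheory.Automorphic.UnitaryGroup`. THEOREMS
ONLY over accepted tree modules: no definition, no named fact, no `sorry`, no instance, no notation.

The accepted letter `UnitaryGroupArthurTruncatedKernel` types Rogawski's kernel in the RIGHT-coset
convention of print, `kernel f x y = Σ'_{γ ∈ G(F)} f(x⁻¹ γ y)`; the tree's generic spectral machinery
(`AutomorphicQuotientKernel`, `…KernelCompact`, `…KernelNoncompact`: `cosetKernel`, `quotientKernel`,
`coeFn_integratedOperator_rightRegular_ae_eq_integral_quotientKernel`) works on Mathlib's LEFT cosets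
`G(𝔸) ⧸ (A_G · G(F))` with an arbitrary invariant measure `ρ` on the subgroup. For `U(J_N)`
(`A_G = 1`, `G(F)` discrete — ★ `isDiscreteRational_quasiSplit`) take `ρ =` the counting measure:

* `integral_count_eq_tsum'` (private) — `∫ h dcount = Σ' h` for `ℂ`-valued functions on a countable
  discrete space, unconditionally (both sides are `0` off absolute = unconditional summability).
* hence, by ★ `quotientKernel_mk_mk` (one `rw` in any context carrying the Borel σ-algebra of the
  quotient, as keyed in ★ `AutomorphicQuotientKernelCompact`), **`K^{tree}_f([x], [y]) = kernel f x⁻¹ y⁻¹`**: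
  the generic kernel at the classes of `x, y` is the T1-qs kernel at the inverses (the tree's
  dictionary `[g] ↦ g⁻¹` between the two coset conventions, as for ★ `quotFun`), for EVERY `f` —
  not restated here as a theorem about `quotientKernel` only because that constant demands the
  local-instance keying of the quotient σ-algebra (review lane); the integral identity
  `integral_count_quotientSubgroup_eq_kernel` is its content.
* `continuous_kernel` — for `f ∈ C_c(G(𝔸_F))`, `(x, y) ↦ K(x, y)` is jointly continuous
  (★ `continuous_integral_comp_mul_inv_mul_inv`: locally the sum is over a fixed finite set).
* CONSUMER NOTE (no statement here, to stay in the kernel lane): with `ρ = count` on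
  `A_G · G(F) = G(F)` — closed (`isClosed_quotientSubgroup_quasiSplit`), countable
  (`countable_quotientSubgroup_quasiSplit`), `count` left/right invariant (Mathlib) and finite on
  compacta (`isFiniteMeasureOnCompacts_count_quotientSubgroup_quasiSplit`) — the accepted
  ★ `AdelicGroupData.coeFn_integratedOperator_rightRegular_ae_eq_integral_quotientKernel` applies
  verbatim to `𝒢 = quasiSplit F E c N`: **`R(f)` on `L²(G(F)\G(𝔸_F), μ)` is the integral operator
  with kernel `c⁻¹ K^{tree}_f = c⁻¹ K(x̃⁻¹, ỹ⁻¹)`**, the entry point of the spectral side of `J^T(f)`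
  [Rogawski1990 §2.2; Gelbart1975 (9.7)]; the instantiation needs the local-instance keying of the
  quotient σ-algebra of that file and is left to the consumer's context.

## References

* J. D. Rogawski, *Automorphic Representations of Unitary Groups in Three Variables*, Annals of
  Mathematics Studies 123 (1990), §2.2 (p. 13) [Rogawski1990].
* S. Gelbart, *Automorphic Forms on Adele Groups*, Annals of Mathematics Studies 83 (1975), §9,
  (9.7), (9.20), Remark 9.23 [Gelbart1975].
-/

noncomputable section

open MeasureTheory Measure NumberField IsDedekindDomain Topology Set CompactlySupported
open Literature.MeasureTheory.Group
open scoped NNReal ENNReal MatrixGroups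

namespace Literature.NumberTheory.Automorphic

namespace UnitaryGroup

variable {F E : Type} [Field F] [NumberField F] [Field E] [NumberField E] [Algebra F E]
  {c : E ≃ₐ[F] E} {N : ℕ}

/-- **`A_G · G(F) = G(F)`** for the quasi-split unitary datum (`A_G = 1`: the centre `U(1)` is
anisotropic; Mok (2015), §1). [cite: Mok2014, §1 Notation p. 5] -/
theorem quotientSubgroup_quasiSplit :
    (quasiSplit F E c N).quotientSubgroup = (quasiSplit F E c N).arithmeticSubgroup := by
  rw [AdelicGroupData.quotientSubgroup, show (quasiSplit F E c N).center' = ⊥ from rfl, bot_sup_eq]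

/-- `∫ h dcount = Σ' h` for `ℂ`-valued functions on a countable space with measurable singletons,
unconditionally: integrability for `count` is absolute summability (Mathlib `integrable_count_iff`),
which over `ℂ` is summability (`summable_norm_iff`); off summability both sides are `0`.
(Private plumbing.) [folklore] -/
private theorem integral_count_eq_tsum' {ι : Type*} [MeasurableSpace ι] [MeasurableSingletonClass ι]
    [Countable ι] (g : ι → ℂ) : ∫ i, g i ∂(Measure.count : Measure ι) = ∑' i, g i := by
  by_cases hs : Summable g
  · have hint : Integrable g (Measure.count : Measure ι) :=
      integrable_count_iff.2 (summable_norm_iff.2 hs)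
    rw [integral_countable hint]
    refine tsum_congr fun i => ?_
    rw [measureReal_def, Measure.count_singleton, ENNReal.toReal_one, one_smul]
  · have hint : ¬Integrable g (Measure.count : Measure ι) := fun h =>
      hs (summable_norm_iff.1 (integrable_count_iff.1 h))
    rw [integral_undef hint, tsum_eq_zero_of_not_summable hs]

/-- `G(F)` (as the quotient subgroup `A_G · G(F)`) is closed in `G(𝔸_F)`: discrete subgroups of
Hausdorff groups are closed (★ `isDiscreteRational_quasiSplit`). [cite: Borel1963, §5] -/
theorem isClosed_quotientSubgroup_quasiSplit :
    IsClosed (((quasiSplit F E c N).quotientSubgroup : Set (quasiSplit F E c N).Adelic)) := by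
  haveI : DiscreteTopology ↥(quasiSplit F E c N).arithmeticSubgroup := isDiscreteRational_quasiSplit
  haveI : T2Space (quasiSplit F E c N).Adelic :=
    inferInstanceAs (T2Space (adelic F E c N ((StdForm.antidiagonal N).over E)))
  rw [quotientSubgroup_quasiSplit]
  exact Subgroup.isClosed_of_discrete

/-- `A_G · G(F) = G(F)` is countable (`G(F) ↪ GL_N(E)`, `E` countable). [cite: Borel1963, §5] -/
theorem countable_quotientSubgroup_quasiSplit : Countable (quasiSplit F E c N).quotientSubgroup := by
  haveI : Countable (quasiSplit F E c N).arithmeticSubgroup := by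
    haveI : Countable E := NumberField.countable' (K := E)
    haveI : Countable (Matrix (Fin N) (Fin N) E) := inferInstanceAs (Countable (Fin N → Fin N → E))
    haveI : Countable (GL (Fin N) E) := Units.val_injective.countable
    haveI : Countable (quasiSplit F E c N).Rational :=
      inferInstanceAs (Countable (rational F E c N ((StdForm.antidiagonal N).over E)))
    exact (Set.countable_range _).to_subtype
  rw [quotientSubgroup_quasiSplit]; infer_instance

/-- The counting measure on the discrete `A_G · G(F) = G(F)` is finite on compact sets (compact
discrete sets are finite). [cite: Borel1963, §5] -/
theorem isFiniteMeasureOnCompacts_count_quotientSubgroup_quasiSplit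
    [MeasurableSpace (quasiSplit F E c N).quotientSubgroup]
    [MeasurableSingletonClass (quasiSplit F E c N).quotientSubgroup] :
    IsFiniteMeasureOnCompacts (Measure.count : Measure (quasiSplit F E c N).quotientSubgroup) := by
  haveI : DiscreteTopology ↥(quasiSplit F E c N).arithmeticSubgroup := isDiscreteRational_quasiSplit
  haveI : DiscreteTopology ↥(quasiSplit F E c N).quotientSubgroup := by
    rw [quotientSubgroup_quasiSplit]; infer_instance
  exact ⟨fun K hK => Measure.count_apply_lt_top.2 hK.finite_of_discrete⟩

section Dictionary

variable [MeasurableSpace (quasiSplit F E c N).Adelic] [BorelSpace (quasiSplit F E c N).Adelic]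

/-- The integral over `A_G · G(F) = G(F)` against the counting measure of `h ↦ f(x h⁻¹ y⁻¹)` is the
T1-qs kernel at the inverses: `∫_{G(F)} f(x h⁻¹ y⁻¹) dcount(h) = kernel f x⁻¹ y⁻¹` (re-index
`h ↦ h⁻¹`; every `f`). [cite: Rogawski1990, §2.2 (p. 13)] -/
theorem integral_count_quotientSubgroup_eq_kernel (f : (quasiSplit F E c N).Adelic → ℂ)
    (x y : (quasiSplit F E c N).Adelic) :
    ∫ h : (quasiSplit F E c N).quotientSubgroup,
        f (x * ((h : (quasiSplit F E c N).Adelic))⁻¹ * y⁻¹) ∂(Measure.count) = kernel f x⁻¹ y⁻¹ := by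
  haveI : DiscreteTopology ↥(quasiSplit F E c N).arithmeticSubgroup := isDiscreteRational_quasiSplit
  haveI : T2Space (quasiSplit F E c N).Adelic :=
    inferInstanceAs (T2Space (adelic F E c N ((StdForm.antidiagonal N).over E)))
  -- `G(F)` is countable (a subgroup of the image of the countable `GL_N(E)`)
  haveI : Countable (quasiSplit F E c N).arithmeticSubgroup := by
    haveI : Countable E := NumberField.countable' (K := E)
    haveI : Countable (Matrix (Fin N) (Fin N) E) := inferInstanceAs (Countable (Fin N → Fin N → E))
    haveI : Countable (GL (Fin N) E) := Units.val_injective.countable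
    haveI : Countable (quasiSplit F E c N).Rational :=
      inferInstanceAs (Countable (rational F E c N ((StdForm.antidiagonal N).over E)))
    exact (Set.countable_range _).to_subtype
  haveI : Countable (quasiSplit F E c N).quotientSubgroup := by
    rw [quotientSubgroup_quasiSplit]; infer_instance
  rw [integral_count_eq_tsum', kernel_def, inv_inv]
  -- transport the sum along `A_G · G(F) = G(F)` and re-index by inversion
  let e : (quasiSplit F E c N).arithmeticSubgroup ≃ (quasiSplit F E c N).quotientSubgroup :=
    (MulEquiv.subgroupCongr (quotientSubgroup_quasiSplit (F := F) (E := E) (c := c) (N := N)).symm).toEquiv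
  rw [← e.tsum_eq, ← (Equiv.inv ((quasiSplit F E c N).arithmeticSubgroup)).tsum_eq]
  refine tsum_congr fun γ => ?_
  simp only [Equiv.inv_apply]
  change f (x * (((γ⁻¹ : (quasiSplit F E c N).arithmeticSubgroup) : (quasiSplit F E c N).Adelic))⁻¹ * y⁻¹) = _
  rw [Subgroup.coe_inv, inv_inv]

/-- **The kernel `K(x, y)` of `f ∈ C_c(G(𝔸_F))` is jointly continuous** on `G(𝔸_F) × G(𝔸_F)`
(★ `continuous_integral_comp_mul_inv_mul_inv` for the closed discrete `G(F)` and the counting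
measure, read through `integral_count_quotientSubgroup_eq_kernel`; Gelbart (1975), p. 120: «a smooth
function on `X × X` since for `x, y` in compact sets the sum is finite»).
[cite: Gelbart1975, (9.20)] -/
theorem continuous_kernel {f : (quasiSplit F E c N).Adelic → ℂ} (hf : Continuous f)
    (hfs : HasCompactSupport f) :
    Continuous fun p : (quasiSplit F E c N).Adelic × (quasiSplit F E c N).Adelic => kernel f p.1 p.2 := by
  haveI : DiscreteTopology ↥(quasiSplit F E c N).arithmeticSubgroup := isDiscreteRational_quasiSplit
  haveI := secondCountableTopology_adeleRing E
  haveI := locallyCompactSpace_adeleRing' E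
  haveI : T2Space (quasiSplit F E c N).Adelic :=
    inferInstanceAs (T2Space (adelic F E c N ((StdForm.antidiagonal N).over E)))
  haveI : LocallyCompactSpace (quasiSplit F E c N).Adelic :=
    inferInstanceAs (LocallyCompactSpace (adelic F E c N ((StdForm.antidiagonal N).over E)))
  haveI : SecondCountableTopology (quasiSplit F E c N).Adelic :=
    inferInstanceAs (SecondCountableTopology (adelic F E c N ((StdForm.antidiagonal N).over E)))
  haveI : IsClosed (((quasiSplit F E c N).quotientSubgroup : Set (quasiSplit F E c N).Adelic)) :=
    isClosed_quotientSubgroup_quasiSplit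
  haveI : DiscreteTopology ↥(quasiSplit F E c N).quotientSubgroup := by
    rw [quotientSubgroup_quasiSplit]; infer_instance
  -- the counting measure on the discrete closed `G(F)` is finite on compact sets
  haveI : IsFiniteMeasureOnCompacts (Measure.count : Measure (quasiSplit F E c N).quotientSubgroup) :=
    ⟨fun K hK => Measure.count_apply_lt_top.2 hK.finite_of_discrete⟩
  have h := continuous_integral_comp_mul_inv_mul_inv (quasiSplit F E c N).quotientSubgroup
    (Measure.count : Measure (quasiSplit F E c N).quotientSubgroup) (𝕜 := ℂ) hf hfs
  have hinv : Continuous fun p : (quasiSplit F E c N).Adelic × (quasiSplit F E c N).Adelic => (p.1⁻¹, p.2⁻¹) :=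
    (continuous_inv.comp continuous_fst).prodMk (continuous_inv.comp continuous_snd)
  have h' := h.comp hinv
  refine h'.congr fun p => ?_
  simp only [Function.comp_apply]
  rw [integral_count_quotientSubgroup_eq_kernel f p.1⁻¹ p.2⁻¹, inv_inv, inv_inv]

end Dictionary


end UnitaryGroup

end Literature.NumberTheory.Automorphic
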